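import Literature.InformationTheory.QuantumCodes.DistanceFailureFloorPhenomenological
import Literature.InformationTheory.QuantumCodes.DepolarizingCSSConverse
import Literature.InformationTheory.QuantumCodes.CSSPhenomenologicalDepolarizing
import HarnessLib

/-!
# The distance FLOOR under DEPOLARIZING noise: sector-wise decoding of a CSS code fails with probability
# `≥ ½·C(d,⌈d/2⌉)·(2p/3)^{⌈d/2⌉}(1−2p/3)^{⌊d/2⌋}`, `d ∈ {d^Z, d^X}`; a depolarizing threshold forces `d^Z, d^X → ∞`

Topic `Literature/InformationTheory/QuantumCodes` (venture QEC, LADDER-QEC rungs Q4/Q5; qec-lit-2 gen 6). Theorem-only;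
no definition, no named fact, no `sorry`.

**Printed statements.** Dennis–Kitaev–Landahl–Preskill 2002, §4.1: the depolarizing channel applies `X`, `Y`, `Z`
each with probability `p/3`; "we will consider the `X` and `Z` errors separately" — the phase-flip part (`Y` or `Z`)
of a depolarizing error is a pattern of INDEPENDENT flips of rate `2p/3`, and likewise the bit-flip part; §3: "In
principle, `L/2` errors could suffice to cause damage to the encoded information". The tree has both ingredients:
`CSSCode.zFailure_le_depolarizingFailureProb` / `xFailure_le_depolarizingFailureProb` (`DepolarizingCSSConverse.lean`:
`P^Z_{2p/3}[D_Z fails] ≤ P^{depol}_p[D_X, D_Z]`, the failure probability `CSSCode.depolarizingFailureProb` of the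
SECTOR-WISE decoder pair of `DepolarizingCSSDecoding.lean`) and the code-capacity distance floor
`CSSCode.distanceFloor_le_zFailure` (`DistanceFailureFloor.lean`, valid for flip rates `≤ ½`). This file composes them:

* **`CSSCode.distanceFloor_dZ_le_depolarizingFailureProb`** / **`…_dX_…`** (`k ≥ 1`, `0 ≤ p ≤ 3/4`): for EVERY pair
  of sector decoders, `½·C(d^Z,⌈d^Z/2⌉)·(2p/3)^{⌈d^Z/2⌉}(1−2p/3)^{⌊d^Z/2⌋} ≤ P^{depol}_p` and the same with `d^X`;
  cruder `½·(2p/3)^{d^Z} ≤ P^{depol}_p` (`half_pow_dZ_le_depolarizingFailureProb`, `…_dX_…`);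
* FAMILIES (`k_i ≥ 1`, any sector-decoder families): bounded `d^Z` (or bounded `d^X`) ⇒ no depolarizing rate
  `0 < p ≤ 3/4` is below threshold and the depolarizing accuracy threshold is `0`
  (`depolarizing_accuracyThreshold_eq_zero_of_dZ_le`, `…_of_dX_le`); conversely
  **`tendsto_dZ_atTop_of_depolarizing_belowThreshold`** and **`tendsto_dX_atTop_of_depolarizing_belowThreshold`**: one
  below-threshold depolarizing rate `0 < p ≤ 3/4` for SOME pair of sector-decoder families forces BOTH `d^Z_i → ∞`
  and `d^X_i → ∞`.

* APPENDED (same session): NOISY SYNDROME MEASUREMENT — for every pair of SPACE-TIME sector decoders of the `T`-round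
  phenomenological depolarizing model (`CSSCode.depolPhenomFailureProb`: qubit depolarizing rate `p`, measurement-fault rates
  `qX`, `qZ ∈ [0,1]`, `T ≥ 1`), the same floors hold: **`CSSCode.distanceFloor_dZ_le_depolPhenomFailureProb`** / `…_dX_…`
  (via the mixture principle of `DistanceFailureFloorPhenomenological.lean` and `CSSCode.zPhenom_le_depolPhenomFailureProb`),
  cruder `half_pow_dZ/dX_le_depolPhenomFailureProb`; families at ANY measurement-rate schedules: bounded `d^Z` or `d^X` ⇒
  accuracy threshold `0` (`depolPhenom_accuracyThreshold_eq_zero_of_dZ/dX_le`); a threshold ⇒ `d^Z, d^X → ∞`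
  (`tendsto_dZ/dX_atTop_of_depolPhenom_belowThreshold`).

Scope: the tree's depolarizing failure probability is that of SECTOR-WISE decoding (the `X`-syndrome decoder applied
to the bit-flip part, the `Z`-syndrome decoder to the phase-flip part — the decoders of every census depolarizing row);
joint decoders exploiting `X/Z` correlations are not covered by `depolarizingFailureProb` and are not claimed here.
The range `p ≤ 3/4` is where the marginal flip rate `2p/3` is `≤ ½`.

## References

* [DennisEtAl2002] E. Dennis, A. Kitaev, A. Landahl, J. Preskill, *Topological quantum memory*, J. Math. Phys. 43
  (2002) 4452 = arXiv:quant-ph/0110143, §4.1 (depolarizing channel; X and Z errors treated separately), §3 (chunk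
  p0010 L3: "L/2 errors could suffice"), §4.3 (below threshold), §4.6 (`p_c`).
* [DumerKovalevPryadko2015] I. Dumer, A. A. Kovalev, L. P. Pryadko, PRL 115 (2015) 050502, eq.
  (succesful-decoding-depolarizing) (sector-wise success under depolarizing noise).
* [Gottesman1997] D. Gottesman, PhD thesis, arXiv:quant-ph/9705052, §2.3 (distance `≥ 2t+1` to correct `t` errors).
-/

namespace Literature.InformationTheory.QuantumCodes

open Finset Matrix Filter Topology

/-! ### One code: the two sector floors at the marginal rate `2p/3` -/

namespace CSSCode

variable {RX RZ V : Type*} [Fintype V] [DecidableEq V] [Fintype RX] [Fintype RZ]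

/-- **DEPOLARIZING DISTANCE FLOOR, `Z`-distance.** For a CSS code with `k ≥ 1`, EVERY pair of sector decoders and
depolarizing rate `0 ≤ p ≤ 3/4`: `½·C(d^Z,⌈d^Z/2⌉)·(2p/3)^{⌈d^Z/2⌉}(1−2p/3)^{⌊d^Z/2⌋} ≤ P^{depol}_p[D_X, D_Z]` (the
phase-flip part is i.i.d. of rate `2p/3`; pairing bound of `DistanceFailureFloor`).
[cite: DennisEtAl2002, §4.1 (X and Z errors separately) and §3 (chunk p0010 L3); DumerKovalevPryadko2015, eq. (succesful-decoding-depolarizing)] -/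
theorem distanceFloor_dZ_le_depolarizingFailureProb (C : CSSCode RX RZ V) (hk : 0 < C.k)
    (DX : Decoder (RZ → ZMod 2) (V → ZMod 2)) (DZ : Decoder (RX → ZMod 2) (V → ZMod 2)) {p : ℝ} (hp0 : 0 ≤ p)
    (hp : p ≤ 3 / 4) :
    1 / 2 * ((C.dZ.choose ((C.dZ + 1) / 2) : ℝ) *
        ((2 * p / 3) ^ ((C.dZ + 1) / 2) * (1 - 2 * p / 3) ^ (C.dZ / 2))) ≤
      C.depolarizingFailureProb DX DZ p :=
  (C.distanceFloor_le_zFailure hk DZ (p := 2 * p / 3) (by positivity) (by linarith)).trans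
    (C.zFailure_le_depolarizingFailureProb DX DZ hp0 (by linarith))

/-- **DEPOLARIZING DISTANCE FLOOR, `X`-distance**: `½·C(d^X,⌈d^X/2⌉)·(2p/3)^{⌈d^X/2⌉}(1−2p/3)^{⌊d^X/2⌋} ≤ P^{depol}_p`
for every pair of sector decoders (`k ≥ 1`, `0 ≤ p ≤ 3/4`; the bit-flip part is i.i.d. of rate `2p/3`).
[cite: DennisEtAl2002, §4.1 and §3 (chunk p0010 L3); DumerKovalevPryadko2015, eq. (succesful-decoding-depolarizing)] -/
theorem distanceFloor_dX_le_depolarizingFailureProb (C : CSSCode RX RZ V) (hk : 0 < C.k)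
    (DX : Decoder (RZ → ZMod 2) (V → ZMod 2)) (DZ : Decoder (RX → ZMod 2) (V → ZMod 2)) {p : ℝ} (hp0 : 0 ≤ p)
    (hp : p ≤ 3 / 4) :
    1 / 2 * ((C.dX.choose ((C.dX + 1) / 2) : ℝ) *
        ((2 * p / 3) ^ ((C.dX + 1) / 2) * (1 - 2 * p / 3) ^ (C.dX / 2))) ≤
      C.depolarizingFailureProb DX DZ p :=
  (C.distanceFloor_le_xFailure hk DX (p := 2 * p / 3) (by positivity) (by linarith)).trans
    (C.xFailure_le_depolarizingFailureProb DX DZ hp0 (by linarith))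

/-- Cruder: `½·(2p/3)^{d^Z} ≤ P^{depol}_p` for every pair of sector decoders (`k ≥ 1`, `0 ≤ p ≤ 3/4`).
[cite: DennisEtAl2002, §4.1 and §3 (chunk p0010 L3)] -/
theorem half_pow_dZ_le_depolarizingFailureProb (C : CSSCode RX RZ V) (hk : 0 < C.k)
    (DX : Decoder (RZ → ZMod 2) (V → ZMod 2)) (DZ : Decoder (RX → ZMod 2) (V → ZMod 2)) {p : ℝ} (hp0 : 0 ≤ p)
    (hp : p ≤ 3 / 4) :
    1 / 2 * (2 * p / 3) ^ C.dZ ≤ C.depolarizingFailureProb DX DZ p :=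
  (C.half_pow_dZ_le_zFailure hk DZ (p := 2 * p / 3) (by positivity) (by linarith)).trans
    (C.zFailure_le_depolarizingFailureProb DX DZ hp0 (by linarith))

/-- Cruder: `½·(2p/3)^{d^X} ≤ P^{depol}_p` for every pair of sector decoders (`k ≥ 1`, `0 ≤ p ≤ 3/4`).
[cite: DennisEtAl2002, §4.1 and §3 (chunk p0010 L3)] -/
theorem half_pow_dX_le_depolarizingFailureProb (C : CSSCode RX RZ V) (hk : 0 < C.k)
    (DX : Decoder (RZ → ZMod 2) (V → ZMod 2)) (DZ : Decoder (RX → ZMod 2) (V → ZMod 2)) {p : ℝ} (hp0 : 0 ≤ p)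
    (hp : p ≤ 3 / 4) :
    1 / 2 * (2 * p / 3) ^ C.dX ≤ C.depolarizingFailureProb DX DZ p :=
  (C.half_pow_dX_le_xFailure hk DX (p := 2 * p / 3) (by positivity) (by linarith)).trans
    (C.xFailure_le_depolarizingFailureProb DX DZ hp0 (by linarith))

end CSSCode

/-! ### Families: bounded distance ⇒ no depolarizing threshold; a threshold ⇒ `d^Z, d^X → ∞` -/

section Families

variable {RX RZ Q : ℕ → Type*} [∀ i, Fintype (Q i)] [∀ i, DecidableEq (Q i)] [∀ i, Fintype (RX i)]
  [∀ i, Fintype (RZ i)]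

/-- **Bounded `Z`-distance ⇒ no depolarizing threshold for ANY sector-decoder families**: if `k_i ≥ 1` and
`d^Z_i ≤ w` for all `i`, no depolarizing rate `0 < p ≤ 3/4` is below threshold (`P^{depol} ≥ ½(2p/3)^w` uniformly).
[cite: DennisEtAl2002, §4.3 (below threshold) and §3 (chunk p0010 L3)] -/
theorem not_belowThreshold_depolarizing_of_dZ_le (C : ∀ i, CSSCode (RX i) (RZ i) (Q i)) (hk : ∀ i, 0 < (C i).k)
    (DX : ∀ i, Decoder (RZ i → ZMod 2) (Q i → ZMod 2)) (DZ : ∀ i, Decoder (RX i → ZMod 2) (Q i → ZMod 2))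
    {w : ℕ} (hw : ∀ i, (C i).dZ ≤ w) {p : ℝ} (hp0 : 0 < p) (hp : p ≤ 3 / 4) :
    ¬ BelowThreshold (fun i p => (C i).depolarizingFailureProb (DX i) (DZ i) p) p := by
  refine not_belowThreshold_of_le (c := 1 / 2 * (2 * p / 3) ^ w) (by positivity) fun i => ?_
  have h := (C i).half_pow_dZ_le_depolarizingFailureProb (hk i) (DX i) (DZ i) hp0.le hp
  have hmono : (2 * p / 3) ^ w ≤ (2 * p / 3) ^ (C i).dZ :=
    pow_le_pow_of_le_one (by positivity) (by linarith) (hw i)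
  linarith

/-- **Bounded `X`-distance ⇒ no depolarizing threshold** for any sector-decoder families (`k_i ≥ 1`, `d^X_i ≤ w`,
`0 < p ≤ 3/4`). [cite: DennisEtAl2002, §4.3 and §3 (chunk p0010 L3)] -/
theorem not_belowThreshold_depolarizing_of_dX_le (C : ∀ i, CSSCode (RX i) (RZ i) (Q i)) (hk : ∀ i, 0 < (C i).k)
    (DX : ∀ i, Decoder (RZ i → ZMod 2) (Q i → ZMod 2)) (DZ : ∀ i, Decoder (RX i → ZMod 2) (Q i → ZMod 2))
    {w : ℕ} (hw : ∀ i, (C i).dX ≤ w) {p : ℝ} (hp0 : 0 < p) (hp : p ≤ 3 / 4) :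
    ¬ BelowThreshold (fun i p => (C i).depolarizingFailureProb (DX i) (DZ i) p) p := by
  refine not_belowThreshold_of_le (c := 1 / 2 * (2 * p / 3) ^ w) (by positivity) fun i => ?_
  have h := (C i).half_pow_dX_le_depolarizingFailureProb (hk i) (DX i) (DZ i) hp0.le hp
  have hmono : (2 * p / 3) ^ w ≤ (2 * p / 3) ^ (C i).dX :=
    pow_le_pow_of_le_one (by positivity) (by linarith) (hw i)
  linarith

/-- **Depolarizing accuracy threshold `0`** for every pair of sector-decoder families of a CSS family with `k_i ≥ 1`
and bounded `Z`-distance. [cite: DennisEtAl2002, §4.6 (p_c) and §3 (chunk p0010 L3)] -/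
theorem depolarizing_accuracyThreshold_eq_zero_of_dZ_le (C : ∀ i, CSSCode (RX i) (RZ i) (Q i))
    (hk : ∀ i, 0 < (C i).k) (DX : ∀ i, Decoder (RZ i → ZMod 2) (Q i → ZMod 2))
    (DZ : ∀ i, Decoder (RX i → ZMod 2) (Q i → ZMod 2)) {w : ℕ} (hw : ∀ i, (C i).dZ ≤ w) :
    accuracyThreshold (fun i p => (C i).depolarizingFailureProb (DX i) (DZ i) p) = 0 :=
  accuracyThreshold_eq_zero_of_not_belowThreshold fun _ hp0 hp =>
    not_belowThreshold_depolarizing_of_dZ_le C hk DX DZ hw hp0 (by linarith)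

/-- **Depolarizing accuracy threshold `0`** for bounded `X`-distance (`k_i ≥ 1`, any sector-decoder families).
[cite: DennisEtAl2002, §4.6 (p_c) and §3 (chunk p0010 L3)] -/
theorem depolarizing_accuracyThreshold_eq_zero_of_dX_le (C : ∀ i, CSSCode (RX i) (RZ i) (Q i))
    (hk : ∀ i, 0 < (C i).k) (DX : ∀ i, Decoder (RZ i → ZMod 2) (Q i → ZMod 2))
    (DZ : ∀ i, Decoder (RX i → ZMod 2) (Q i → ZMod 2)) {w : ℕ} (hw : ∀ i, (C i).dX ≤ w) :
    accuracyThreshold (fun i p => (C i).depolarizingFailureProb (DX i) (DZ i) p) = 0 :=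
  accuracyThreshold_eq_zero_of_not_belowThreshold fun _ hp0 hp =>
    not_belowThreshold_depolarizing_of_dX_le C hk DX DZ hw hp0 (by linarith)

/-- **A DEPOLARIZING THRESHOLD FORCES `d^Z → ∞`.** If `k_i ≥ 1` and SOME pair of sector-decoder families is below
threshold at SOME depolarizing rate `0 < p ≤ 3/4`, then `d^Z_i → ∞`.
[cite: DennisEtAl2002, §4.3 (below threshold) and §3 (chunk p0008 L5, p0010 L3)] -/
theorem tendsto_dZ_atTop_of_depolarizing_belowThreshold (C : ∀ i, CSSCode (RX i) (RZ i) (Q i))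
    (hk : ∀ i, 0 < (C i).k) (DX : ∀ i, Decoder (RZ i → ZMod 2) (Q i → ZMod 2))
    (DZ : ∀ i, Decoder (RX i → ZMod 2) (Q i → ZMod 2)) {p : ℝ} (hp0 : 0 < p) (hp : p ≤ 3 / 4)
    (h : BelowThreshold (fun i p => (C i).depolarizingFailureProb (DX i) (DZ i) p) p) :
    Tendsto (fun i => (C i).dZ) atTop atTop := by
  unfold BelowThreshold at h
  rw [tendsto_atTop]
  intro w
  have hc : (0 : ℝ) < 1 / 2 * (2 * p / 3) ^ w := by positivity
  refine (h.eventually (gt_mem_nhds hc)).mono fun i hi => ?_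
  by_contra hlt
  push Not at hlt
  have h1 := (C i).half_pow_dZ_le_depolarizingFailureProb (hk i) (DX i) (DZ i) hp0.le hp
  have hmono : (2 * p / 3) ^ w ≤ (2 * p / 3) ^ (C i).dZ :=
    pow_le_pow_of_le_one (by positivity) (by linarith) hlt.le
  have hi' : (C i).depolarizingFailureProb (DX i) (DZ i) p < 1 / 2 * (2 * p / 3) ^ w := hi
  linarith

/-- **A DEPOLARIZING THRESHOLD FORCES `d^X → ∞`** (`k_i ≥ 1`; some pair of sector-decoder families below threshold at
some `0 < p ≤ 3/4`). [cite: DennisEtAl2002, §4.3 and §3 (chunk p0010 L3)] -/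
theorem tendsto_dX_atTop_of_depolarizing_belowThreshold (C : ∀ i, CSSCode (RX i) (RZ i) (Q i))
    (hk : ∀ i, 0 < (C i).k) (DX : ∀ i, Decoder (RZ i → ZMod 2) (Q i → ZMod 2))
    (DZ : ∀ i, Decoder (RX i → ZMod 2) (Q i → ZMod 2)) {p : ℝ} (hp0 : 0 < p) (hp : p ≤ 3 / 4)
    (h : BelowThreshold (fun i p => (C i).depolarizingFailureProb (DX i) (DZ i) p) p) :
    Tendsto (fun i => (C i).dX) atTop atTop := by
  unfold BelowThreshold at h
  rw [tendsto_atTop]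
  intro w
  have hc : (0 : ℝ) < 1 / 2 * (2 * p / 3) ^ w := by positivity
  refine (h.eventually (gt_mem_nhds hc)).mono fun i hi => ?_
  by_contra hlt
  push Not at hlt
  have h1 := (C i).half_pow_dX_le_depolarizingFailureProb (hk i) (DX i) (DZ i) hp0.le hp
  have hmono : (2 * p / 3) ^ w ≤ (2 * p / 3) ^ (C i).dX :=
    pow_le_pow_of_le_one (by positivity) (by linarith) hlt.le
  have hi' : (C i).depolarizingFailureProb (DX i) (DZ i) p < 1 / 2 * (2 * p / 3) ^ w := hi
  linarith

end Families

/-! ### Noisy syndrome measurement: the depolarizing floor for every pair of SPACE-TIME sector decoders -/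

namespace CSSCode

open CSSPhenom

variable {RX RZ V : Type*} [Fintype V] [DecidableEq V] [Fintype RX] [DecidableEq RX] [Fintype RZ] [DecidableEq RZ]

/-- **DEPOLARIZING DISTANCE FLOOR UNDER NOISY MEASUREMENT, `Z`-distance.** For a CSS code with `k ≥ 1`, `T ≥ 1` rounds,
EVERY pair of space-time sector decoders, depolarizing rate `0 ≤ p ≤ 3/4` and ANY measurement-fault rates
`qX, qZ ∈ [0,1]`: `½·C(d^Z,⌈d^Z/2⌉)·(2p/3)^{⌈d^Z/2⌉}(1−2p/3)^{⌊d^Z/2⌋} ≤ P^{depol,ph}_{p,qX,qZ}` (the phase-flip record is the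
one-sector phenomenological model at qubit rate `2p/3`; mixture principle + pairing bound).
[cite: DennisEtAl2002, §4.1–4.2 (separate recovery; error histories) and §3 (chunk p0010 L3); DumerKovalevPryadko2015, eq. (succesful-decoding-depolarizing)] -/
theorem distanceFloor_dZ_le_depolPhenomFailureProb (C : CSSCode RX RZ V) (hk : 0 < C.k) {T : ℕ}
    (DZ : STDecoder RX V T) (DX : STDecoder RZ V T) (t₀ : Fin T) {p qX qZ : ℝ} (hp0 : 0 ≤ p) (hp : p ≤ 3 / 4)
    (hqX0 : 0 ≤ qX) (hqX1 : qX ≤ 1) (hqZ0 : 0 ≤ qZ) (hqZ1 : qZ ≤ 1) :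
    1 / 2 * ((C.dZ.choose ((C.dZ + 1) / 2) : ℝ) *
        ((2 * p / 3) ^ ((C.dZ + 1) / 2) * (1 - 2 * p / 3) ^ (C.dZ / 2))) ≤
      C.depolPhenomFailureProb T DZ DX p qX qZ :=
  (C.distanceFloor_le_zPhenomFailureProb hk DZ t₀ (p := 2 * p / 3) (by positivity) (by linarith) hqX0 hqX1).trans
    (C.zPhenom_le_depolPhenomFailureProb T DZ DX hp0 (by linarith) hqX0 hqX1 hqZ0 hqZ1)

/-- **DEPOLARIZING DISTANCE FLOOR UNDER NOISY MEASUREMENT, `X`-distance**: the `d^X` twin (bit-flip record at qubit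
rate `2p/3`, measurement rate `qZ`). [cite: DennisEtAl2002, §4.1–4.2 and §3 (chunk p0010 L3); DumerKovalevPryadko2015, eq. (succesful-decoding-depolarizing)] -/
theorem distanceFloor_dX_le_depolPhenomFailureProb (C : CSSCode RX RZ V) (hk : 0 < C.k) {T : ℕ}
    (DZ : STDecoder RX V T) (DX : STDecoder RZ V T) (t₀ : Fin T) {p qX qZ : ℝ} (hp0 : 0 ≤ p) (hp : p ≤ 3 / 4)
    (hqX0 : 0 ≤ qX) (hqX1 : qX ≤ 1) (hqZ0 : 0 ≤ qZ) (hqZ1 : qZ ≤ 1) :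
    1 / 2 * ((C.dX.choose ((C.dX + 1) / 2) : ℝ) *
        ((2 * p / 3) ^ ((C.dX + 1) / 2) * (1 - 2 * p / 3) ^ (C.dX / 2))) ≤
      C.depolPhenomFailureProb T DZ DX p qX qZ :=
  (C.distanceFloor_le_xPhenomFailureProb hk DX t₀ (p := 2 * p / 3) (by positivity) (by linarith) hqZ0 hqZ1).trans
    (C.xPhenom_le_depolPhenomFailureProb T DZ DX hp0 (by linarith) hqX0 hqX1 hqZ0 hqZ1)

/-- Cruder: `½·(2p/3)^{d^Z} ≤ P^{depol,ph}` for every pair of space-time sector decoders (`k ≥ 1`, `T ≥ 1`,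
`0 ≤ p ≤ 3/4`, `qX, qZ ∈ [0,1]`). [cite: DennisEtAl2002, §4.1–4.2 and §3 (chunk p0010 L3)] -/
theorem half_pow_dZ_le_depolPhenomFailureProb (C : CSSCode RX RZ V) (hk : 0 < C.k) {T : ℕ}
    (DZ : STDecoder RX V T) (DX : STDecoder RZ V T) (t₀ : Fin T) {p qX qZ : ℝ} (hp0 : 0 ≤ p) (hp : p ≤ 3 / 4)
    (hqX0 : 0 ≤ qX) (hqX1 : qX ≤ 1) (hqZ0 : 0 ≤ qZ) (hqZ1 : qZ ≤ 1) :
    1 / 2 * (2 * p / 3) ^ C.dZ ≤ C.depolPhenomFailureProb T DZ DX p qX qZ :=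
  (C.half_pow_dZ_le_zPhenomFailureProb hk DZ t₀ (p := 2 * p / 3) (by positivity) (by linarith) hqX0 hqX1).trans
    (C.zPhenom_le_depolPhenomFailureProb T DZ DX hp0 (by linarith) hqX0 hqX1 hqZ0 hqZ1)

/-- Cruder: `½·(2p/3)^{d^X} ≤ P^{depol,ph}` for every pair of space-time sector decoders (`k ≥ 1`, `T ≥ 1`,
`0 ≤ p ≤ 3/4`, `qX, qZ ∈ [0,1]`). [cite: DennisEtAl2002, §4.1–4.2 and §3 (chunk p0010 L3)] -/
theorem half_pow_dX_le_depolPhenomFailureProb (C : CSSCode RX RZ V) (hk : 0 < C.k) {T : ℕ}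
    (DZ : STDecoder RX V T) (DX : STDecoder RZ V T) (t₀ : Fin T) {p qX qZ : ℝ} (hp0 : 0 ≤ p) (hp : p ≤ 3 / 4)
    (hqX0 : 0 ≤ qX) (hqX1 : qX ≤ 1) (hqZ0 : 0 ≤ qZ) (hqZ1 : qZ ≤ 1) :
    1 / 2 * (2 * p / 3) ^ C.dX ≤ C.depolPhenomFailureProb T DZ DX p qX qZ :=
  (C.half_pow_dX_le_xPhenomFailureProb hk DX t₀ (p := 2 * p / 3) (by positivity) (by linarith) hqZ0 hqZ1).trans
    (C.xPhenom_le_depolPhenomFailureProb T DZ DX hp0 (by linarith) hqX0 hqX1 hqZ0 hqZ1)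

end CSSCode

section PhenomFamilies

open CSSPhenom

variable {RX RZ Q : ℕ → Type*} [∀ i, Fintype (Q i)] [∀ i, DecidableEq (Q i)] [∀ i, Fintype (RX i)]
  [∀ i, DecidableEq (RX i)] [∀ i, Fintype (RZ i)] [∀ i, DecidableEq (RZ i)]

/-- **Bounded `Z`-distance ⇒ no phenomenological-depolarizing threshold** for ANY space-time sector-decoder families,
any numbers of rounds `T_i ≥ 1` and ANY measurement-rate schedules `qX_i(p), qZ_i(p) ∈ [0,1]` (`k_i ≥ 1`, `d^Z_i ≤ w`,
`0 < p ≤ 3/4`). [cite: DennisEtAl2002, §4.2–4.3 (error histories; below threshold) and §3 (chunk p0010 L3)] -/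
theorem not_belowThreshold_depolPhenom_of_dZ_le (C : ∀ i, CSSCode (RX i) (RZ i) (Q i)) (hk : ∀ i, 0 < (C i).k)
    (T : ℕ → ℕ) (hT : ∀ i, 0 < T i) (DZ : ∀ i, STDecoder (RX i) (Q i) (T i)) (DX : ∀ i, STDecoder (RZ i) (Q i) (T i))
    (qX qZ : ℕ → ℝ → ℝ) (hqX : ∀ i r, 0 ≤ qX i r ∧ qX i r ≤ 1) (hqZ : ∀ i r, 0 ≤ qZ i r ∧ qZ i r ≤ 1)
    {w : ℕ} (hw : ∀ i, (C i).dZ ≤ w) {p : ℝ} (hp0 : 0 < p) (hp : p ≤ 3 / 4) :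
    ¬ BelowThreshold (fun i p => (C i).depolPhenomFailureProb (T i) (DZ i) (DX i) p (qX i p) (qZ i p)) p := by
  refine not_belowThreshold_of_le (c := 1 / 2 * (2 * p / 3) ^ w) (by positivity) fun i => ?_
  have h := (C i).half_pow_dZ_le_depolPhenomFailureProb (hk i) (DZ i) (DX i) ⟨0, hT i⟩ hp0.le hp (hqX i p).1
    (hqX i p).2 (hqZ i p).1 (hqZ i p).2
  have hmono : (2 * p / 3) ^ w ≤ (2 * p / 3) ^ (C i).dZ :=
    pow_le_pow_of_le_one (by positivity) (by linarith) (hw i)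
  linarith

/-- **Bounded `X`-distance ⇒ no phenomenological-depolarizing threshold** (any space-time sector-decoder families, any
`T_i ≥ 1`, any measurement-rate schedules; `k_i ≥ 1`, `d^X_i ≤ w`, `0 < p ≤ 3/4`).
[cite: DennisEtAl2002, §4.2–4.3 and §3 (chunk p0010 L3)] -/
theorem not_belowThreshold_depolPhenom_of_dX_le (C : ∀ i, CSSCode (RX i) (RZ i) (Q i)) (hk : ∀ i, 0 < (C i).k)
    (T : ℕ → ℕ) (hT : ∀ i, 0 < T i) (DZ : ∀ i, STDecoder (RX i) (Q i) (T i)) (DX : ∀ i, STDecoder (RZ i) (Q i) (T i))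
    (qX qZ : ℕ → ℝ → ℝ) (hqX : ∀ i r, 0 ≤ qX i r ∧ qX i r ≤ 1) (hqZ : ∀ i r, 0 ≤ qZ i r ∧ qZ i r ≤ 1)
    {w : ℕ} (hw : ∀ i, (C i).dX ≤ w) {p : ℝ} (hp0 : 0 < p) (hp : p ≤ 3 / 4) :
    ¬ BelowThreshold (fun i p => (C i).depolPhenomFailureProb (T i) (DZ i) (DX i) p (qX i p) (qZ i p)) p := by
  refine not_belowThreshold_of_le (c := 1 / 2 * (2 * p / 3) ^ w) (by positivity) fun i => ?_
  have h := (C i).half_pow_dX_le_depolPhenomFailureProb (hk i) (DZ i) (DX i) ⟨0, hT i⟩ hp0.le hp (hqX i p).1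
    (hqX i p).2 (hqZ i p).1 (hqZ i p).2
  have hmono : (2 * p / 3) ^ w ≤ (2 * p / 3) ^ (C i).dX :=
    pow_le_pow_of_le_one (by positivity) (by linarith) (hw i)
  linarith

/-- **Phenomenological-depolarizing accuracy threshold `0`** for bounded `Z`-distance (every space-time sector-decoder
families, any `T_i ≥ 1`, any measurement-rate schedules; `k_i ≥ 1`). [cite: DennisEtAl2002, §4.6 (p_c) and §3 (chunk p0010 L3)] -/
theorem depolPhenom_accuracyThreshold_eq_zero_of_dZ_le (C : ∀ i, CSSCode (RX i) (RZ i) (Q i))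
    (hk : ∀ i, 0 < (C i).k) (T : ℕ → ℕ) (hT : ∀ i, 0 < T i) (DZ : ∀ i, STDecoder (RX i) (Q i) (T i))
    (DX : ∀ i, STDecoder (RZ i) (Q i) (T i)) (qX qZ : ℕ → ℝ → ℝ) (hqX : ∀ i r, 0 ≤ qX i r ∧ qX i r ≤ 1)
    (hqZ : ∀ i r, 0 ≤ qZ i r ∧ qZ i r ≤ 1) {w : ℕ} (hw : ∀ i, (C i).dZ ≤ w) :
    accuracyThreshold (fun i p => (C i).depolPhenomFailureProb (T i) (DZ i) (DX i) p (qX i p) (qZ i p)) = 0 :=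
  accuracyThreshold_eq_zero_of_not_belowThreshold fun _ hp0 hp =>
    not_belowThreshold_depolPhenom_of_dZ_le C hk T hT DZ DX qX qZ hqX hqZ hw hp0 (by linarith)

/-- **Phenomenological-depolarizing accuracy threshold `0`** for bounded `X`-distance.
[cite: DennisEtAl2002, §4.6 (p_c) and §3 (chunk p0010 L3)] -/
theorem depolPhenom_accuracyThreshold_eq_zero_of_dX_le (C : ∀ i, CSSCode (RX i) (RZ i) (Q i))
    (hk : ∀ i, 0 < (C i).k) (T : ℕ → ℕ) (hT : ∀ i, 0 < T i) (DZ : ∀ i, STDecoder (RX i) (Q i) (T i))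
    (DX : ∀ i, STDecoder (RZ i) (Q i) (T i)) (qX qZ : ℕ → ℝ → ℝ) (hqX : ∀ i r, 0 ≤ qX i r ∧ qX i r ≤ 1)
    (hqZ : ∀ i r, 0 ≤ qZ i r ∧ qZ i r ≤ 1) {w : ℕ} (hw : ∀ i, (C i).dX ≤ w) :
    accuracyThreshold (fun i p => (C i).depolPhenomFailureProb (T i) (DZ i) (DX i) p (qX i p) (qZ i p)) = 0 :=
  accuracyThreshold_eq_zero_of_not_belowThreshold fun _ hp0 hp =>
    not_belowThreshold_depolPhenom_of_dX_le C hk T hT DZ DX qX qZ hqX hqZ hw hp0 (by linarith)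

/-- **A PHENOMENOLOGICAL-DEPOLARIZING THRESHOLD FORCES `d^Z → ∞`**: if `k_i ≥ 1`, `T_i ≥ 1` and SOME pair of space-time
sector-decoder families is below threshold at SOME depolarizing rate `0 < p ≤ 3/4` under SOME measurement-rate schedules in
`[0,1]`, then `d^Z_i → ∞`. [cite: DennisEtAl2002, §4.2–4.3 (below threshold) and §3 (chunk p0008 L5, p0010 L3)] -/
theorem tendsto_dZ_atTop_of_depolPhenom_belowThreshold (C : ∀ i, CSSCode (RX i) (RZ i) (Q i))
    (hk : ∀ i, 0 < (C i).k) (T : ℕ → ℕ) (hT : ∀ i, 0 < T i) (DZ : ∀ i, STDecoder (RX i) (Q i) (T i))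
    (DX : ∀ i, STDecoder (RZ i) (Q i) (T i)) (qX qZ : ℕ → ℝ → ℝ) (hqX : ∀ i r, 0 ≤ qX i r ∧ qX i r ≤ 1)
    (hqZ : ∀ i r, 0 ≤ qZ i r ∧ qZ i r ≤ 1) {p : ℝ} (hp0 : 0 < p) (hp : p ≤ 3 / 4)
    (h : BelowThreshold (fun i p => (C i).depolPhenomFailureProb (T i) (DZ i) (DX i) p (qX i p) (qZ i p)) p) :
    Tendsto (fun i => (C i).dZ) atTop atTop := by
  unfold BelowThreshold at h
  rw [tendsto_atTop]
  intro w
  have hc : (0 : ℝ) < 1 / 2 * (2 * p / 3) ^ w := by positivity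
  refine (h.eventually (gt_mem_nhds hc)).mono fun i hi => ?_
  by_contra hlt
  push Not at hlt
  have h1 := (C i).half_pow_dZ_le_depolPhenomFailureProb (hk i) (DZ i) (DX i) ⟨0, hT i⟩ hp0.le hp (hqX i p).1
    (hqX i p).2 (hqZ i p).1 (hqZ i p).2
  have hmono : (2 * p / 3) ^ w ≤ (2 * p / 3) ^ (C i).dZ :=
    pow_le_pow_of_le_one (by positivity) (by linarith) hlt.le
  have hi' : (C i).depolPhenomFailureProb (T i) (DZ i) (DX i) p (qX i p) (qZ i p) < 1 / 2 * (2 * p / 3) ^ w := hi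
  linarith

/-- **A PHENOMENOLOGICAL-DEPOLARIZING THRESHOLD FORCES `d^X → ∞`** (`k_i ≥ 1`, `T_i ≥ 1`; some pair of space-time
sector-decoder families below threshold at some `0 < p ≤ 3/4`, any measurement-rate schedules in `[0,1]`).
[cite: DennisEtAl2002, §4.2–4.3 and §3 (chunk p0010 L3)] -/
theorem tendsto_dX_atTop_of_depolPhenom_belowThreshold (C : ∀ i, CSSCode (RX i) (RZ i) (Q i))
    (hk : ∀ i, 0 < (C i).k) (T : ℕ → ℕ) (hT : ∀ i, 0 < T i) (DZ : ∀ i, STDecoder (RX i) (Q i) (T i))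
    (DX : ∀ i, STDecoder (RZ i) (Q i) (T i)) (qX qZ : ℕ → ℝ → ℝ) (hqX : ∀ i r, 0 ≤ qX i r ∧ qX i r ≤ 1)
    (hqZ : ∀ i r, 0 ≤ qZ i r ∧ qZ i r ≤ 1) {p : ℝ} (hp0 : 0 < p) (hp : p ≤ 3 / 4)
    (h : BelowThreshold (fun i p => (C i).depolPhenomFailureProb (T i) (DZ i) (DX i) p (qX i p) (qZ i p)) p) :
    Tendsto (fun i => (C i).dX) atTop atTop := by
  unfold BelowThreshold at h
  rw [tendsto_atTop]
  intro w
  have hc : (0 : ℝ) < 1 / 2 * (2 * p / 3) ^ w := by positivity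
  refine (h.eventually (gt_mem_nhds hc)).mono fun i hi => ?_
  by_contra hlt
  push Not at hlt
  have h1 := (C i).half_pow_dX_le_depolPhenomFailureProb (hk i) (DZ i) (DX i) ⟨0, hT i⟩ hp0.le hp (hqX i p).1
    (hqX i p).2 (hqZ i p).1 (hqZ i p).2
  have hmono : (2 * p / 3) ^ w ≤ (2 * p / 3) ^ (C i).dX :=
    pow_le_pow_of_le_one (by positivity) (by linarith) hlt.le
  have hi' : (C i).depolPhenomFailureProb (T i) (DZ i) (DX i) p (qX i p) (qZ i p) < 1 / 2 * (2 * p / 3) ^ w := hi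
  linarith

end PhenomFamilies

end Literature.InformationTheory.QuantumCodes
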